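import Summits.HodgeConjecture.HodgeConjecture.Theorems.NikulinTwinTransportLefschetzOneOneK3Holomorphy
import Literature.Geometry.Kaehler.LocalFormsGlue

/-!
# Route NikulinTwinTransport — `LefschetzOneOneK3`, `∂∂̄`–exponential line: pointwise `∂`/`∂̄` calculus of functions

Pointwise versions, for functions smooth only on an open set, of the tree's global Dolbeault
identities (`d = ∂ + ∂̄`, `∂² = 0`, `∂∂̄ + ∂̄∂ = 0`, additivity), obtained by localisation with a
bump function and the locality of `∂`, `∂̄`, `d`: smoothness of `∂ψ` and `d(∂ψ) = -∂∂̄ψ` at the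
points where `ψ` is smooth; `ℂ`-linearity and additivity of `ψ ↦ ∂ψ`, `ψ ↦ ∂∂̄ψ` at such points;
and `∂χ = dG` when `χ = G + K` with `G` holomorphic and `K` antiholomorphic (Voisin I, §2.3.3).
Helper file for the reduction of the route item `LefschetzOneOneK3`.
-/

noncomputable section

open scoped Manifold ContDiff Topology ComplexConjugate
open Set Filter
open Literature.Geometry.Kaehler
open Literature.NumberTheory.Transcendental
open Literature.Analysis.Complex (typeProjAt typeProjAt_add)

namespace Summit.HodgeConjecture.HodgeConjecture.Theorems

section Calculus

variable {E : Type} [NormedAddCommGroup E] [NormedSpace ℂ E] [FiniteDimensional ℂ E]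
  {M : Type} [TopologicalSpace M] [ChartedSpace E M] [IsManifold 𝓘(ℂ, E) ω M]
  [IsManifold 𝓘(ℝ, E) ∞ M] [T2Space M]

/-! ### Localisation -/

omit [IsManifold 𝓘(ℂ, E) ω M] in
/-- **Localisation.** A form smooth at the points of an open `W` agrees near each `x ∈ W` with a
GLOBALLY smooth form (`f • α` for a smooth bump function `f` equal to `1` near `x` with
`tsupport f ⊆ W`). [folklore] -/
theorem exists_isSmoothForm_eventuallyEq {k : ℕ} {W : Set M} (hW : IsOpen W)
    {α : MForm 𝓘(ℝ, E) M ℂ k} (hα : ∀ z ∈ W, α.SmoothAt z) {x : M} (hx : x ∈ W) :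
    ∃ β : MForm 𝓘(ℝ, E) M ℂ k, IsSmoothForm β ∧ ∀ᶠ z in 𝓝 x, β z = α z := by
  obtain ⟨f, -, hf⟩ := (SmoothBumpFunction.nhds_basis_tsupport (I := 𝓘(ℝ, E)) x).mem_iff.1
    (hW.mem_nhds hx)
  refine ⟨(f : M → ℝ) • α, ?_, ?_⟩
  · refine (isSmoothForm_iff_smoothAt _).2 fun z ↦ ?_
    by_cases hz : z ∈ W
    · exact (hα z hz).fun_smul f.contMDiff.contMDiffAt
    · have h0 : (f : M → ℝ) =ᶠ[𝓝 z] 0 := notMem_tsupport_iff_eventuallyEq.1 fun h ↦ hz (hf h)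
      refine MForm.smoothAt_of_eventuallyEq_zero ?_
      filter_upwards [h0] with w hw
      rw [Pi.smul_apply', hw, Pi.zero_apply, zero_smul]
  · filter_upwards [f.eventuallyEq_one] with z hz
    rw [Pi.smul_apply', hz, Pi.one_apply, one_smul]

/-! ### Global identities (smooth forms) -/

omit [FiniteDimensional ℂ E] [T2Space M] in
/-- `∂` of a smooth form is smooth (the tree's `isSmoothForm_dolbeault`, fed). [cite: VoisinHodgeI2002, §2.3.3] -/
theorem isSmoothForm_dolbeault' {k : ℕ} {β : MForm 𝓘(ℝ, E) M ℂ k} (hβ : IsSmoothForm β) :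
    IsSmoothForm (dolbeault β) :=
  isSmoothForm_dolbeault isSmoothForm_typeComponent_holds (fun hγ ↦ hγ.mextDeriv) hβ

omit [FiniteDimensional ℂ E] [T2Space M] in
/-- `∂̄` of a smooth form is smooth (the tree's `isSmoothForm_dolbeaultBar`, fed). [cite: VoisinHodgeI2002, §2.3.3] -/
theorem isSmoothForm_dolbeaultBar' {k : ℕ} {β : MForm 𝓘(ℝ, E) M ℂ k} (hβ : IsSmoothForm β) :
    IsSmoothForm (dolbeaultBar β) :=
  isSmoothForm_dolbeaultBar isSmoothForm_typeComponent_holds (fun hγ ↦ hγ.mextDeriv) hβ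

omit [FiniteDimensional ℂ E] [T2Space M] in
/-- **`d(∂β) = -∂∂̄β`** for a smooth form (`d = ∂ + ∂̄`, `∂² = 0`, `∂∂̄ + ∂̄∂ = 0`).
[cite: VoisinHodgeI2002, §2.3.3] -/
theorem mextDeriv_dolbeault_of_isSmoothForm {k : ℕ} {β : MForm 𝓘(ℝ, E) M ℂ k}
    (hβ : IsSmoothForm β) : mextDeriv (dolbeault β) = -dolbeault (dolbeaultBar β) := by
  rw [mextDeriv_eq_dolbeault_add_dolbeaultBar_holds (isSmoothForm_dolbeault' hβ),
    dolbeault_dolbeault_holds hβ, zero_add]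
  exact eq_neg_of_add_eq_zero_right (dolbeault_dolbeaultBar_add_dolbeaultBar_dolbeault_holds hβ)

omit [FiniteDimensional ℂ E] [T2Space M] in
/-- `∂` of a difference of smooth forms. [cite: VoisinHodgeI2002, §2.3.3] -/
theorem dolbeault_sub_of_isSmoothForm {k : ℕ} {α β : MForm 𝓘(ℝ, E) M ℂ k}
    (hα : IsSmoothForm α) (hβ : IsSmoothForm β) :
    dolbeault (α - β) = dolbeault α - dolbeault β := by
  rw [sub_eq_add_neg, ← neg_one_smul ℂ β, dolbeault_add isSmoothForm_typeComponent_holds hα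
    (hβ.smul_complex _), dolbeault_smul_holds, neg_one_smul, sub_eq_add_neg]

omit [FiniteDimensional ℂ E] [T2Space M] in
/-- `∂̄` of a difference of smooth forms. [cite: VoisinHodgeI2002, §2.3.3] -/
theorem dolbeaultBar_sub_of_isSmoothForm {k : ℕ} {α β : MForm 𝓘(ℝ, E) M ℂ k}
    (hα : IsSmoothForm α) (hβ : IsSmoothForm β) :
    dolbeaultBar (α - β) = dolbeaultBar α - dolbeaultBar β := by
  rw [sub_eq_add_neg, ← neg_one_smul ℂ β, dolbeaultBar_add isSmoothForm_typeComponent_holds hα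
    (hβ.smul_complex _), dolbeaultBar_smul_holds, neg_one_smul, sub_eq_add_neg]

/-! ### `∂ψ` and `d(∂ψ) = -∂∂̄ψ` for functions smooth on an open set -/

/-- **Smoothness of `∂ψ` and `d(∂ψ) = -∂∂̄ψ` at the points of an open set on which `ψ` is smooth.**
[cite: VoisinHodgeI2002, §2.3.3] -/
theorem mextDeriv_dolbeault_ofFun {V : Set M} (hV : IsOpen V) {ψ : M → ℂ}
    (hψ : ∀ x ∈ V, (MForm.ofFun 𝓘(ℝ, E) ψ).SmoothAt x) {x : M} (hx : x ∈ V) :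
    (dolbeault (MForm.ofFun 𝓘(ℝ, E) ψ)).SmoothAt x ∧
      mextDeriv (dolbeault (MForm.ofFun 𝓘(ℝ, E) ψ)) x =
        -dolbeault (dolbeaultBar (MForm.ofFun 𝓘(ℝ, E) ψ)) x := by
  obtain ⟨β, hβs, hβ⟩ := exists_isSmoothForm_eventuallyEq hV hψ hx
  have h1 : ∀ᶠ z in 𝓝 x, dolbeault β z = dolbeault (MForm.ofFun 𝓘(ℝ, E) ψ) z :=
    dolbeault_eventuallyEq_of_eventuallyEq hβ
  have h2 : ∀ᶠ z in 𝓝 x, dolbeaultBar β z = dolbeaultBar (MForm.ofFun 𝓘(ℝ, E) ψ) z :=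
    dolbeaultBar_eventuallyEq_of_eventuallyEq hβ
  refine ⟨((isSmoothForm_iff_smoothAt _).1 (isSmoothForm_dolbeault' hβs) x).congr_of_eventuallyEq h1,
    ?_⟩
  rw [← mextDeriv_congr_of_eventuallyEq h1, mextDeriv_dolbeault_of_isSmoothForm hβs, Pi.neg_apply,
    dolbeault_congr_of_eventuallyEq h2]

/-! ### Linearity of `ψ ↦ ∂ψ`, `ψ ↦ ∂∂̄ψ` -/

omit [FiniteDimensional ℂ E] [IsManifold 𝓘(ℂ, E) ω M] [IsManifold 𝓘(ℝ, E) ∞ M] [T2Space M] in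
/-- `ofFun` of a pointwise scalar multiple. [folklore] -/
theorem ofFun_const_mul (c : ℂ) (f : M → ℂ) :
    (MForm.ofFun 𝓘(ℝ, E) fun y ↦ c * f y) = c • MForm.ofFun 𝓘(ℝ, E) f := by
  funext x; ext v; rfl

omit [FiniteDimensional ℂ E] [IsManifold 𝓘(ℂ, E) ω M] [IsManifold 𝓘(ℝ, E) ∞ M] [T2Space M] in
/-- `ofFun` of a pointwise difference. [folklore] -/
theorem ofFun_sub (f g : M → ℂ) :
    (MForm.ofFun 𝓘(ℝ, E) fun y ↦ f y - g y) = MForm.ofFun 𝓘(ℝ, E) f - MForm.ofFun 𝓘(ℝ, E) g := by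
  funext x; ext v; rfl

omit [FiniteDimensional ℂ E] [IsManifold 𝓘(ℂ, E) ω M] [IsManifold 𝓘(ℝ, E) ∞ M] [T2Space M] in
/-- A complex scalar multiple of a form smooth at a point is smooth there. [folklore] -/
theorem smoothAt_smul_complex (c : ℂ) {k : ℕ} {γ : MForm 𝓘(ℝ, E) M ℂ k} {x : M}
    (h : γ.SmoothAt x) : (c • γ).SmoothAt x := by
  rw [MForm.SmoothAt, MForm.inChart_smul_complex]
  exact ContDiffWithinAt.const_smul c h

omit [FiniteDimensional ℂ E] [IsManifold 𝓘(ℂ, E) ω M] [IsManifold 𝓘(ℝ, E) ∞ M] [T2Space M] in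
/-- **`∂(cψ) = c ∂ψ` and `∂∂̄(cψ) = c ∂∂̄ψ`** (no smoothness needed), together with smoothness of
`cψ` where `ψ` is smooth. [cite: VoisinHodgeI2002, §2.3.3] -/
theorem dolbeault_ofFun_const_mul {V : Set M} {ψ : M → ℂ} (c : ℂ)
    (h : ∀ x ∈ V, (MForm.ofFun 𝓘(ℝ, E) ψ).SmoothAt x) {x : M} (hx : x ∈ V) :
    (MForm.ofFun 𝓘(ℝ, E) fun y ↦ c * ψ y).SmoothAt x ∧
      dolbeault (MForm.ofFun 𝓘(ℝ, E) fun y ↦ c * ψ y) x = c • dolbeault (MForm.ofFun 𝓘(ℝ, E) ψ) x ∧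
      dolbeault (dolbeaultBar (MForm.ofFun 𝓘(ℝ, E) fun y ↦ c * ψ y)) x =
        c • dolbeault (dolbeaultBar (MForm.ofFun 𝓘(ℝ, E) ψ)) x := by
  rw [ofFun_const_mul]
  refine ⟨smoothAt_smul_complex c (h x hx), ?_, ?_⟩
  · rw [dolbeault_smul_holds]; rfl
  · rw [dolbeaultBar_smul_holds, dolbeault_smul_holds]; rfl

/-- **`∂(ψ₁ - ψ₂) = ∂ψ₁ - ∂ψ₂` and `∂∂̄(ψ₁ - ψ₂) = ∂∂̄ψ₁ - ∂∂̄ψ₂` at the points of an open set on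
which both functions are smooth** (localisation + the global additivity). [cite: VoisinHodgeI2002, §2.3.3] -/
theorem dolbeault_ofFun_sub {V : Set M} (hV : IsOpen V) {ψ₁ ψ₂ : M → ℂ}
    (h₁ : ∀ x ∈ V, (MForm.ofFun 𝓘(ℝ, E) ψ₁).SmoothAt x)
    (h₂ : ∀ x ∈ V, (MForm.ofFun 𝓘(ℝ, E) ψ₂).SmoothAt x) {x : M} (hx : x ∈ V) :
    (MForm.ofFun 𝓘(ℝ, E) fun y ↦ ψ₁ y - ψ₂ y).SmoothAt x ∧
      dolbeault (MForm.ofFun 𝓘(ℝ, E) fun y ↦ ψ₁ y - ψ₂ y) x =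
        dolbeault (MForm.ofFun 𝓘(ℝ, E) ψ₁) x - dolbeault (MForm.ofFun 𝓘(ℝ, E) ψ₂) x ∧
      dolbeault (dolbeaultBar (MForm.ofFun 𝓘(ℝ, E) fun y ↦ ψ₁ y - ψ₂ y)) x =
        dolbeault (dolbeaultBar (MForm.ofFun 𝓘(ℝ, E) ψ₁)) x -
          dolbeault (dolbeaultBar (MForm.ofFun 𝓘(ℝ, E) ψ₂)) x := by
  rw [ofFun_sub]
  obtain ⟨α, hαs, hα⟩ := exists_isSmoothForm_eventuallyEq hV h₁ hx
  obtain ⟨β, hβs, hβ⟩ := exists_isSmoothForm_eventuallyEq hV h₂ hx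
  have hsub : ∀ᶠ z in 𝓝 x, (α - β) z = (MForm.ofFun 𝓘(ℝ, E) ψ₁ - MForm.ofFun 𝓘(ℝ, E) ψ₂) z := by
    filter_upwards [hα, hβ] with z hz hz'
    rw [Pi.sub_apply, Pi.sub_apply, hz, hz']
  refine ⟨(h₁ x hx).sub (h₂ x hx), ?_, ?_⟩
  · rw [← dolbeault_congr_of_eventuallyEq hsub, dolbeault_sub_of_isSmoothForm hαs hβs, Pi.sub_apply,
      dolbeault_congr_of_eventuallyEq hα, dolbeault_congr_of_eventuallyEq hβ]
  · have hb : ∀ᶠ z in 𝓝 x, dolbeaultBar (α - β) z =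
        dolbeaultBar (MForm.ofFun 𝓘(ℝ, E) ψ₁ - MForm.ofFun 𝓘(ℝ, E) ψ₂) z :=
      dolbeaultBar_eventuallyEq_of_eventuallyEq hsub
    rw [← dolbeault_congr_of_eventuallyEq hb, dolbeaultBar_sub_of_isSmoothForm hαs hβs,
      dolbeault_sub_of_isSmoothForm (isSmoothForm_dolbeaultBar' hαs) (isSmoothForm_dolbeaultBar' hβs),
      Pi.sub_apply, dolbeault_congr_of_eventuallyEq (dolbeaultBar_eventuallyEq_of_eventuallyEq hα),
      dolbeault_congr_of_eventuallyEq (dolbeaultBar_eventuallyEq_of_eventuallyEq hβ)]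

/-! ### `∂χ = dG` for `χ = G + K`, `G` holomorphic, `K` antiholomorphic -/

omit [FiniteDimensional ℂ E] [IsManifold 𝓘(ℂ, E) ω M] [IsManifold 𝓘(ℝ, E) ∞ M] [T2Space M] in
/-- Additivity of `∂` on `0`-forms at a point where both are smooth (`∂φ = (dφ)^{1,0}` and
additivity of `d` at the point). [cite: VoisinHodgeI2002, §2.3.3] -/
theorem dolbeault_add_apply_zeroForm {φ₁ φ₂ : MForm 𝓘(ℝ, E) M ℂ 0} {x : M}
    (h₁ : φ₁.SmoothAt x) (h₂ : φ₂.SmoothAt x) :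
    dolbeault (φ₁ + φ₂) x = dolbeault φ₁ x + dolbeault φ₂ x := by
  rw [dolbeault_zeroForm, dolbeault_zeroForm, dolbeault_zeroForm, typeComponent_apply_eq_typeProjAt,
    typeComponent_apply_eq_typeProjAt, typeComponent_apply_eq_typeProjAt, mextDeriv_add_apply h₁ h₂]
  exact typeProjAt_add 1 0 _ _

omit [T2Space M] in
/-- The `0`-form of a holomorphic function is smooth at the points of its open set. [folklore] -/
theorem smoothAt_ofFun_of_hol {V : Set M} (hV : IsOpen V) {G : M → ℂ}
    (hG : MDifferentiableOn 𝓘(ℂ, E) 𝓘(ℂ, ℂ) G V) {x : M} (hx : x ∈ V) :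
    (MForm.ofFun 𝓘(ℝ, E) G).SmoothAt x :=
  MForm.smoothAt_ofFun_of_contMDiffAt (contMDiffAt_real_of_mdifferentiableOn_complex hG hV hx)

omit [T2Space M] in
/-- **`∂χ = dG` on the open set `V` when `χ = G + K` there with `G` holomorphic and `K`
antiholomorphic** (`∂G = dG`, `∂K = 0`). [cite: VoisinHodgeI2002, §2.3.3] -/
theorem dolbeault_ofFun_eq_mextDeriv_of_hol_add_antihol {V : Set M} (hV : IsOpen V) {χ G K : M → ℂ}
    (hG : MDifferentiableOn 𝓘(ℂ, E) 𝓘(ℂ, ℂ) G V)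
    (hK : MDifferentiableOn 𝓘(ℂ, E) 𝓘(ℂ, ℂ) (fun y ↦ conj (K y)) V)
    (h : ∀ x ∈ V, χ x = G x + K x) {x : M} (hx : x ∈ V) :
    dolbeault (MForm.ofFun 𝓘(ℝ, E) χ) x = mextDeriv (MForm.ofFun 𝓘(ℝ, E) G) x := by
  have hev : ∀ᶠ z in 𝓝 x, (MForm.ofFun 𝓘(ℝ, E) G + MForm.ofFun 𝓘(ℝ, E) K) z =
      MForm.ofFun 𝓘(ℝ, E) χ z := by
    filter_upwards [hV.mem_nhds hx] with z hz
    ext v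
    simp [MForm.ofFun_apply, h z hz]
  rw [← dolbeault_congr_of_eventuallyEq hev,
    dolbeault_add_apply_zeroForm (smoothAt_ofFun_of_hol hV hG hx)
      (smoothAt_ofFun_of_conj_mdifferentiableOn hV hK hx),
    dolbeault_ofFun_eq_mextDeriv_of_mdifferentiableOn hV hG hx,
    dolbeault_ofFun_eq_zero_of_conj_mdifferentiableOn hV hK hx, add_zero]

end Calculus

end Summit.HodgeConjecture.HodgeConjecture.Theorems

end
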